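import Summits.AtomisticToContinuum.Crystallization.Theses.SquareWellLayerCake
import Literature.MathematicalPhysics.StatisticalMechanics.LennardJonesClusters
import Literature.Geometry.DiscreteGeometry.SphericalCodeHemisphere
import Literature.Geometry.DiscreteGeometry.TammesThirteen

/-!
# Disproof of `TwelveWithinOne` — findings (cdisprove, crux stmt-AtomisticToContinuum-15808, cycle 1)

Crux (route `SquareWellLayerCake`, K2): for every sequence of Lennard-Jones ground states the
fraction of particles `i` failing
`Good i := [every particle within 11/10 of x_i (x_i included) is 55/57-separated from all others]
  ∧ [at least 12 particles j ≠ i with dist(x_i, x_j) ≤ 1]`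
tends to `0` (`V_LJ = r⁻¹²/12 − r⁻⁶/6`, minimum at `r = 1`; ground states are injective minimisers,
`Literature…Crystallization.IsGroundState`).

## Verdict of this cycle: NO KILL — the statement resists, for a structural reason

`¬ TwelveWithinOne` asks for actual Lennard-Jones minimisers, for infinitely many `N`, carrying a
positive DENSITY of defect sites.  The only a-priori information on 3-D LJ minimisers in print or in
tree is: existence (`LennardJonesGroundStatesExist_holds`), uniform minimal distance (`1/3` proved,
`0.684` named: `Yuhjtman2015_minDistance`), site energies `≤ 0`, energy bounds — none of which
forces a defect anywhere except at the boundary (Part C below: every convex-hull vertex IS a defect,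
but that is `o(N)`).  Conversely the conjectured minimiser (hcp/fcc bulk, `a* = 0.97123`) satisfies
`Good` at every interior site with margins `0.65 %` (`a* − 55/57`) and `2.9 %` (`1 − a*`); second
shell `√2·a* = 1.3735 > 11/10`.  So a refutation inside the model would be a negative solution of the
(local) crystallization problem against the universal numerical evidence; no formalisation defect
was found to short-cut it (no junk: `Nat.card`/cast, `0/0 = 0` only at `N = 0`, closed balls,
injectivity built into `IsGroundState`, ground states exist for every `N` so the hypothesis is not
vacuous).  Numerics (python, this session, seconds): the LJ13 icosahedral minimiser has radial bonds
`0.96381 < 55/57 = 0.96491` — every site of it is a defect; Mackay icosahedra are more compressed,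
so the defect fraction is `≈ 1` throughout the icosahedral regime: the crux is purely asymptotic and
admits no rate better than the surface scale (Part C).

## What IS proved here (all sorry-free; landed copies under `Theorems/TwelveWithinOne/Negative/`)

* Part A — LOAD-BEARING HYPOTHESES.
  `twelveWithinOne_false_without_minimality`: drop energy minimisation (keep injectivity) ⇒ FALSE
  (collinear configuration `i ↦ 2i·e₀`: no particle has a neighbour within 1).
  `not_withinOneFor_zero`: the same statement for the ZERO potential is FALSE (every injective
  configuration is a ground state of `V = 0`, `isGroundState_zero`) — any proof must use the
  attractive well of `V_LJ`, not just `IsGroundState`-formalities.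
* Part B — TIGHTNESS OF THE COUNT (modulo the named fact `musinTarasov2012_tammes_thirteen`,
  Tammes `N = 13`, chord threshold `0.957`): at a `55/57`-separated site AT MOST twelve particles lie
  within distance `1` (`nbrCount_le_twelve`: bond directions form a spherical code of chord
  `≥ 55/57 = 0.9649 > 0.957`, worst case two bonds of length exactly `1`), hence
  `not_withinOneFor_of_thirteen_le`: replacing `12` by any `m ≥ 13` makes the crux FALSE.  So under
  K2 a.e. site has EXACTLY twelve within `1` — the `= 12` that `closes` extracts from K1 is already
  forced pointwise by clause (a); K1 (`AveragedTwelve`) is needed in `closes` only for the EMPTY SHELL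
  `(1, 11/10]`.
* Part C — THE EXCEPTIONAL SET IS ESSENTIAL (unconditional).  `not_goodWith_twelve_of_extreme`: in
  ANY finite configuration a particle extreme in some direction fails `Good` — its bond directions
  would be `≥ 12` unit vectors in a closed hemisphere pairwise at angle `≥ 57.69°`
  (`cos ≤ 1 − (55/57)²/2 = 0.53447`), against the cap-packing bound
  `card_mul_le_of_code_in_hemisphere` with `c = 219/250`: `12·(1 − c) = 1.488 > 1 + √(1 − c²) =
  1.48231` (margin `0.4 %`; the bound allows at most `11`).  Hence `exists_not_goodWith_twelve`,
  `one_le_card_bad` (the defect set of the crux is never empty, for every `N ≥ 1` and EVERY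
  configuration, ground state or not) and `not_twelveWithinOneEverywhere`: the natural strengthening
  "eventually every particle is Good" is FALSE.  Every vertex of the convex hull is a defect; the
  `o(N)` in K2 must absorb the whole surface.
* Part D — SANITY (positive, workfile only): `goodWith_twelve_fcc13` — the predicate IS satisfiable
  (centre of the fcc cluster `fcc13` at bond length `7√2/10 = 0.98995`; 78 integer squared
  distances by `decide`), so K2 is not false for the trivial reason; in a large fcc/hcp chunk at any
  scale in `[55/57, 1]` every interior site is Good and (Part C) every hull vertex is not.

## For the provers (why-it-resists, one line each)

1. No static counterexample exists: `¬K2` needs the minimisers themselves (open problem).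
2. The margins are `0.65 % / 2.9 %` around `a*`; B1–B2 of `BarrierNotesIdeator2.md` (decoupled
   layer-cake budgets cannot pin them; site energies must be resolved to `5.8e-4`) are consistent
   with everything here.
3. Part B says clause (b) can never be over-satisfied: there is no slack to trade between sites —
   an averaged first-zone count `P(1) ≥ 6N − o(N)` on the separated sites is EQUIVALENT to the
   per-site clause (b) a.e. GIVEN clause (a) (each separated site has ≤ 12, so the deficit
   `Σ (12 − count)₊ = 12·#sep − P` counts the (b)-failures among separated sites exactly).
4. Part C: any proof must be genuinely asymptotic (surface sites always fail); a proof "for all i"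
   at fixed large `N` is impossible.
-/

noncomputable section

namespace Summit.AtomisticToContinuum.Crystallization.Cruxes.TwelveWithinOne.Disproof

open scoped BigOperators
open Filter Finset RealInnerProductSpace
open Literature.MathematicalPhysics.StatisticalMechanics
open Literature.Geometry.DiscreteGeometry
open Summit.AtomisticToContinuum.Crystallization.Theses.SquareWellLayerCake (TwelveWithinOne)

local notation "E3" => EuclideanSpace ℝ (Fin 3)

/-! ## The predicates of the crux, parametrised by potential and count threshold -/

/-- Clause (a) of the crux at site `i`: every particle within `11/10` of `x i` (including `i`) has
all its other distances `≥ 55/57`. -/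
def SepNbhd {N : ℕ} (x : Fin N → E3) (i : Fin N) : Prop :=
  ∀ j : Fin N, dist (x i) (x j) ≤ 11 / 10 → ∀ k : Fin N, k ≠ j → (55 : ℝ) / 57 ≤ dist (x j) (x k)

/-- The neighbours of `i` within distance `1`. -/
def nbrs {N : ℕ} (x : Fin N → E3) (i : Fin N) : Finset (Fin N) :=
  Finset.univ.filter fun j : Fin N => j ≠ i ∧ dist (x i) (x j) ≤ 1

/-- Clause (b) with threshold `m` (crux: `m = 12`) joined to clause (a). -/
def GoodWith (m : ℕ) {N : ℕ} (x : Fin N → E3) (i : Fin N) : Prop :=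
  SepNbhd x i ∧ m ≤ (nbrs x i).card

/-- The defect fraction of the `N`-th configuration of a sequence. -/
def badFraction (m : ℕ) (x : (N : ℕ) → (Fin N → E3)) (N : ℕ) : ℝ :=
  (Nat.card {i : Fin N // ¬ GoodWith m (x N) i} : ℝ) / N

/-- The crux parametrised by the pair potential `V` and the count threshold `m`. -/
def WithinOneFor (V : ℝ → ℝ) (m : ℕ) : Prop :=
  ∀ x : (N : ℕ) → (Fin N → E3), (∀ N, IsGroundState V (x N)) →
    Tendsto (badFraction m x) atTop (nhds 0)

/-- The crux is the instance `V = V_LJ`, `m = 12` (definitional). -/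
theorem twelveWithinOne_iff : TwelveWithinOne ↔ WithinOneFor lennardJones 12 := Iff.rfl

/-- Skeleton of every negative statement below: if a site predicate fails at EVERY site for all
`N ≥ 1`, the defect fraction is eventually `1` and does not tend to `0`. -/
theorem not_tendsto_of_forall_not {P : (N : ℕ) → Fin N → Prop}
    (hP : ∀ N : ℕ, 1 ≤ N → ∀ i : Fin N, ¬ P N i) :
    ¬ Tendsto (fun N : ℕ => (Nat.card {i : Fin N // ¬ P N i} : ℝ) / N) atTop (nhds 0) := by
  intro h
  have h1 : (fun N : ℕ => (Nat.card {i : Fin N // ¬ P N i} : ℝ) / N) =ᶠ[atTop]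
      fun _ => (1 : ℝ) := by
    filter_upwards [eventually_ge_atTop 1] with N hN
    have hc : Nat.card {i : Fin N // ¬ P N i} = N := by
      rw [Nat.card_congr (Equiv.subtypeUnivEquiv (hP N hN)), Nat.card_eq_fintype_card,
        Fintype.card_fin]
    have hN' : (N : ℝ) ≠ 0 := Nat.cast_ne_zero.2 (by omega)
    rw [hc, div_self hN']
  exact zero_ne_one (tendsto_nhds_unique (h.congr' h1) tendsto_const_nhds)

/-! ## Part A — load-bearing hypotheses: minimality, and the potential itself -/

/-- The spread-out collinear configuration `i ↦ 2i·e₀`. -/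
def spread (N : ℕ) : Fin N → E3 := fun i => EuclideanSpace.single (0 : Fin 3) (2 * ((i : ℕ) : ℝ))

/-- Distinct particles of `spread N` are at distance `≥ 2`. -/
theorem two_le_dist_spread {N : ℕ} {i j : Fin N} (hij : i ≠ j) :
    2 ≤ dist (spread N i) (spread N j) := by
  have h : dist (spread N i) (spread N j) = |2 * ((i : ℕ) : ℝ) - 2 * ((j : ℕ) : ℝ)| := by
    simp [spread, Real.dist_eq]
  rw [h]
  have hne : (i : ℕ) ≠ (j : ℕ) := fun h' => hij (Fin.ext h')
  rcases Nat.lt_or_gt_of_ne hne with hlt | hlt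
  · have : ((i : ℕ) : ℝ) + 1 ≤ ((j : ℕ) : ℝ) := by exact_mod_cast hlt
    rw [abs_of_nonpos (by linarith)]; linarith
  · have : ((j : ℕ) : ℝ) + 1 ≤ ((i : ℕ) : ℝ) := by exact_mod_cast hlt
    rw [abs_of_nonneg (by linarith)]; linarith

/-- `spread N` is injective (a configuration of distinct points). -/
theorem spread_injective (N : ℕ) : Function.Injective (spread N) := fun i j h => by
  by_contra hij
  have := two_le_dist_spread hij
  rw [h, dist_self] at this
  linarith

/-- No particle of `spread N` has a neighbour within distance `1`. -/
theorem nbrs_spread {N : ℕ} (i : Fin N) : nbrs (spread N) i = ∅ := by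
  rw [nbrs, Finset.filter_eq_empty_iff]
  rintro j - ⟨hji, hd⟩
  have := two_le_dist_spread (N := N) (Ne.symm hji)
  linarith

/-- Hence every site of `spread N` is a defect for every threshold `m ≥ 1`. -/
theorem not_goodWith_spread {m N : ℕ} (hm : 1 ≤ m) (i : Fin N) : ¬ GoodWith m (spread N) i := by
  rintro ⟨-, hcount⟩
  rw [nbrs_spread, Finset.card_empty] at hcount
  omega

/-- The crux with energy minimisation DROPPED (injectivity, the other half of `IsGroundState`,
kept). -/
def TwelveWithinOneWithoutMinimality : Prop :=
  ∀ x : (N : ℕ) → (Fin N → E3), (∀ N, Function.Injective (x N)) →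
    Tendsto (badFraction 12 x) atTop (nhds 0)

/-- **Minimality is load-bearing**: without it the statement is false (witness `spread`). -/
theorem twelveWithinOne_false_without_minimality : ¬ TwelveWithinOneWithoutMinimality := fun h =>
  not_tendsto_of_forall_not (P := fun N i => GoodWith 12 (spread N) i)
    (fun _ _ i => not_goodWith_spread (by norm_num) i) (h spread spread_injective)

/-- **The potential is load-bearing**: for the zero potential (every configuration of distinct
points is a ground state, `isGroundState_zero`) the statement is false. -/
theorem not_withinOneFor_zero : ¬ WithinOneFor (fun _ => 0) 12 := fun h =>
  not_tendsto_of_forall_not (P := fun N i => GoodWith 12 (spread N) i)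
    (fun _ _ i => not_goodWith_spread (by norm_num) i)
    (h spread fun N => isGroundState_zero (spread_injective N))

/-! ## Part B — the spherical code of bond directions at a separated site; tightness of `12` -/

/-- Two bonds `p, q` of lengths in `[55/57, 1]` whose far ends are `≥ 55/57` apart make an angle
with cosine `≤ 1 − (55/57)²/2` (worst case: both of length `1`). -/
theorem inner_normalized_le {p q : E3} (hp1 : (55 : ℝ) / 57 ≤ ‖p‖) (hp2 : ‖p‖ ≤ 1)
    (hq1 : (55 : ℝ) / 57 ≤ ‖q‖) (hq2 : ‖q‖ ≤ 1) (hpq : (55 : ℝ) / 57 ≤ ‖p - q‖) :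
    ⟪‖p‖⁻¹ • p, ‖q‖⁻¹ • q⟫ ≤ 1 - ((55 : ℝ) / 57) ^ 2 / 2 := by
  have hp0 : 0 < ‖p‖ := by linarith
  have hq0 : 0 < ‖q‖ := by linarith
  have hinner : ⟪p, q⟫ = (‖p‖ ^ 2 + ‖q‖ ^ 2 - ‖p - q‖ ^ 2) / 2 := by
    rw [norm_sub_sq_real]; ring
  have hpq2 : ((55 : ℝ) / 57) ^ 2 ≤ ‖p - q‖ ^ 2 := pow_le_pow_left₀ (by norm_num) hpq 2
  have key : ⟪p, q⟫ ≤ (1 - ((55 : ℝ) / 57) ^ 2 / 2) * (‖p‖ * ‖q‖) := by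
    rw [hinner]
    nlinarith [mul_nonneg (sub_nonneg.2 hp2) (sub_nonneg.2 hp1),
      mul_nonneg (sub_nonneg.2 hq2) (sub_nonneg.2 hq1),
      mul_nonneg (sub_nonneg.2 hp2) (sub_nonneg.2 hq2)]
  rw [real_inner_smul_left, real_inner_smul_right, ← mul_assoc, ← mul_inv,
    inv_mul_le_iff₀ (by positivity)]
  linarith [key]

variable {N : ℕ}

/-- Membership in the neighbour finset. [folklore] -/
theorem mem_nbrs {x : Fin N → E3} {i j : Fin N} :
    j ∈ nbrs x i ↔ j ≠ i ∧ dist (x i) (x j) ≤ 1 := by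
  simp [nbrs]

/-- At a separated site the bonds have lengths in `[55/57, 1]`. -/
theorem norm_sub_mem {x : Fin N → E3} {i j : Fin N} (hsep : SepNbhd x i) (hj : j ∈ nbrs x i) :
    (55 : ℝ) / 57 ≤ ‖x j - x i‖ ∧ ‖x j - x i‖ ≤ 1 := by
  rw [mem_nbrs] at hj
  rw [← dist_eq_norm, dist_comm]
  exact ⟨hsep i (by rw [dist_self]; norm_num) j hj.1, hj.2⟩

/-- … and distinct neighbours are `≥ 55/57` apart. -/
theorem norm_sub_sub {x : Fin N → E3} {i j k : Fin N} (hsep : SepNbhd x i) (hj : j ∈ nbrs x i)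
    (hjk : j ≠ k) : (55 : ℝ) / 57 ≤ ‖(x j - x i) - (x k - x i)‖ := by
  rw [sub_sub_sub_cancel_right, ← dist_eq_norm]
  rw [mem_nbrs] at hj
  exact hsep j (hj.2.trans (by norm_num)) k hjk.symm

/-- The unit bond direction from `x i` to `x j`. -/
def dir (x : Fin N → E3) (i j : Fin N) : E3 := ‖x j - x i‖⁻¹ • (x j - x i)

/-- Bond directions at a separated site are unit vectors. [folklore] -/
theorem norm_dir {x : Fin N → E3} {i j : Fin N} (hsep : SepNbhd x i) (hj : j ∈ nbrs x i) :
    ‖dir x i j‖ = 1 := by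
  have h0 : 0 < ‖x j - x i‖ := by linarith [(norm_sub_mem hsep hj).1]
  rw [dir, norm_smul, norm_inv, norm_norm, inv_mul_cancel₀ h0.ne']

/-- Pairwise inner products of bond directions at a separated site are `≤ 1 − (55/57)²/2`. [folklore] -/
theorem inner_dir_le {x : Fin N → E3} {i j k : Fin N} (hsep : SepNbhd x i) (hj : j ∈ nbrs x i)
    (hk : k ∈ nbrs x i) (hjk : j ≠ k) : ⟪dir x i j, dir x i k⟫ ≤ 1 - ((55 : ℝ) / 57) ^ 2 / 2 :=
  inner_normalized_le (norm_sub_mem hsep hj).1 (norm_sub_mem hsep hj).2 (norm_sub_mem hsep hk).1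
    (norm_sub_mem hsep hk).2 (norm_sub_sub hsep hj hjk)

/-- Distinct neighbours have distinct bond directions. [folklore] -/
theorem dir_injOn {x : Fin N → E3} {i : Fin N} (hsep : SepNbhd x i) :
    Set.InjOn (dir x i) (nbrs x i) := by
  intro j hj k hk hjk
  by_contra hne
  have h1 := inner_dir_le hsep hj hk hne
  rw [hjk, real_inner_self_eq_norm_sq, norm_dir hsep hk] at h1
  norm_num at h1

/-- The spherical code of bond directions at site `i`. -/
def code (x : Fin N → E3) (i : Fin N) : Finset E3 := (nbrs x i).image (dir x i)

/-- The code has as many elements as there are neighbours within `1`. [folklore] -/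
theorem card_code {x : Fin N → E3} {i : Fin N} (hsep : SepNbhd x i) :
    (code x i).card = (nbrs x i).card :=
  Finset.card_image_of_injOn (dir_injOn hsep)

/-- The code consists of unit vectors. [folklore] -/
theorem code_norm {x : Fin N → E3} {i : Fin N} (hsep : SepNbhd x i) :
    ∀ v ∈ code x i, ‖v‖ = 1 := by
  intro v hv
  obtain ⟨j, hj, rfl⟩ := Finset.mem_image.1 hv
  exact norm_dir hsep hj

/-- The code has pairwise inner products `≤ 1 − (55/57)²/2`. [folklore] -/
theorem code_inner {x : Fin N → E3} {i : Fin N} (hsep : SepNbhd x i) :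
    ∀ v ∈ code x i, ∀ w ∈ code x i, v ≠ w → ⟪v, w⟫ ≤ 1 - ((55 : ℝ) / 57) ^ 2 / 2 := by
  intro v hv w hw hvw
  obtain ⟨j, hj, rfl⟩ := Finset.mem_image.1 hv
  obtain ⟨k, hk, rfl⟩ := Finset.mem_image.1 hw
  exact inner_dir_le hsep hj hk fun h => hvw (by rw [h])

/-- The code has chord `≥ 55/57 > 0.957`, the threshold of the Tammes-13 fact. -/
theorem code_dist {x : Fin N → E3} {i : Fin N} (hsep : SepNbhd x i) :
    ∀ v ∈ code x i, ∀ w ∈ code x i, v ≠ w → (0.957 : ℝ) ≤ dist v w := by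
  intro v hv w hw hvw
  have hin := code_inner hsep v hv w hw hvw
  have hsq : dist v w ^ 2 = 2 - 2 * ⟪v, w⟫ := by
    rw [dist_eq_norm, norm_sub_sq_real, code_norm hsep v hv, code_norm hsep w hw]; ring
  nlinarith [dist_nonneg (x := v) (y := w)]

/-- **Tightness of the count** (modulo Tammes-13, `musinTarasov2012_tammes_thirteen`): at a
`55/57`-separated site at most twelve particles lie within distance `1`. -/
theorem card_nbrs_le_twelve (hT : musinTarasov2012_tammes_thirteen) {x : Fin N → E3} {i : Fin N}
    (hsep : SepNbhd x i) : (nbrs x i).card ≤ 12 := by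
  rw [← card_code hsep]
  exact hT (code x i) (code_norm hsep) (code_dist hsep)

/-- Hence no site anywhere satisfies the predicate with `13` (or more) in place of `12`. -/
theorem not_goodWith_of_thirteen_le (hT : musinTarasov2012_tammes_thirteen) {m : ℕ} (hm : 13 ≤ m)
    {x : Fin N → E3} (i : Fin N) : ¬ GoodWith m x i := by
  rintro ⟨hsep, hcount⟩
  have := card_nbrs_le_twelve hT hsep
  omega

/-- A fixed sequence of Lennard-Jones ground states (they exist for every `N`). -/
def gs (N : ℕ) : Fin N → E3 := (LennardJonesGroundStatesExist_holds N).choose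

/-- `gs N` is a Lennard-Jones ground state. [folklore] -/
theorem gs_isGroundState (N : ℕ) : IsGroundState lennardJones (gs N) :=
  (LennardJonesGroundStatesExist_holds N).choose_spec

/-- **The count `12` cannot be raised** (modulo Tammes-13): `WithinOneFor lennardJones m` is false
for every `m ≥ 13`. -/
theorem not_withinOneFor_of_thirteen_le (hT : musinTarasov2012_tammes_thirteen) {m : ℕ}
    (hm : 13 ≤ m) : ¬ WithinOneFor lennardJones m := fun h =>
  not_tendsto_of_forall_not (P := fun N i => GoodWith m (gs N) i)
    (fun _ _ i => not_goodWith_of_thirteen_le hT hm i) (h gs gs_isGroundState)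

/-! ## Part C — surface sites are always defects: the exceptional set is essential -/

/-- **A particle extreme in some direction is a defect**, in every configuration: its bond
directions would be `≥ 12` unit vectors of a closed hemisphere pairwise at inner product
`≤ 1 − (55/57)²/2 ≤ 2·(219/250)² − 1`, but the cap-packing bound allows at most
`(1 + √(1 − c²))/(1 − c) = 11.95…` of them. -/
theorem not_goodWith_twelve_of_extreme {x : Fin N → E3} {a : E3} (ha : ‖a‖ = 1) {i : Fin N}
    (hmax : ∀ j : Fin N, ⟪a, x j⟫ ≤ ⟪a, x i⟫) : ¬ GoodWith 12 x i := by
  rintro ⟨hsep, hcount⟩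
  have hna : ‖-a‖ = 1 := by rw [norm_neg, ha]
  have hhem : ∀ v ∈ code x i, 0 ≤ ⟪-a, v⟫ := by
    intro v hv
    obtain ⟨j, hj, rfl⟩ := Finset.mem_image.1 hv
    have h0 : 0 < ‖x j - x i‖ := by linarith [(norm_sub_mem hsep hj).1]
    rw [dir, real_inner_smul_right, inner_neg_left, inner_sub_right]
    exact mul_nonneg (inv_nonneg.2 h0.le) (by linarith [hmax j])
  have hsep' : ∀ v ∈ code x i, ∀ w ∈ code x i, v ≠ w → ⟪v, w⟫ ≤ 2 * (219 / 250 : ℝ) ^ 2 - 1 :=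
    fun v hv w hw hvw => (code_inner hsep v hv w hw hvw).trans (by norm_num)
  have hb := card_mul_le_of_code_in_hemisphere (code_norm hsep) (c := 219 / 250) (by norm_num)
    (by norm_num) hsep' hna hhem
  have hsqrt : Real.sqrt (1 - (219 / 250 : ℝ) ^ 2) < 488 / 1000 := by
    rw [Real.sqrt_lt' (by norm_num)]; norm_num
  rw [card_code hsep] at hb
  have h12 : (12 : ℝ) ≤ (nbrs x i).card := by exact_mod_cast hcount
  linarith

/-- Hence **every non-empty configuration has a defect site** (take the particle maximising a
coordinate). -/
theorem exists_not_goodWith_twelve (hN : 1 ≤ N) (x : Fin N → E3) : ∃ i : Fin N, ¬ GoodWith 12 x i := by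
  have ha : ‖(EuclideanSpace.single (0 : Fin 3) (1 : ℝ) : E3)‖ = 1 := by simp
  have hne : (Finset.univ : Finset (Fin N)).Nonempty := Finset.univ_nonempty_iff.2 ⟨⟨0, hN⟩⟩
  obtain ⟨i, -, hi⟩ := Finset.exists_max_image Finset.univ
    (fun j => ⟪(EuclideanSpace.single (0 : Fin 3) (1 : ℝ) : E3), x j⟫) hne
  exact ⟨i, not_goodWith_twelve_of_extreme ha fun j => hi j (Finset.mem_univ j)⟩

/-- Quantitative form: the defect set of the crux is never empty (`N ≥ 1`, any configuration). -/
theorem one_le_card_bad (hN : 1 ≤ N) (x : Fin N → E3) :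
    1 ≤ Nat.card {i : Fin N // ¬ GoodWith 12 x i} := by
  obtain ⟨i, hi⟩ := exists_not_goodWith_twelve hN x
  have : Nonempty {i : Fin N // ¬ GoodWith 12 x i} := ⟨⟨i, hi⟩⟩
  exact Nat.card_pos

/-- The natural strengthening with NO exceptional set: eventually every particle is Good. -/
def TwelveWithinOneEverywhere : Prop :=
  ∀ x : (N : ℕ) → (Fin N → E3), (∀ N, IsGroundState lennardJones (x N)) →
    ∀ᶠ N in atTop, ∀ i : Fin N, GoodWith 12 (x N) i

/-- **The exceptional set is essential**: the everywhere-version is false. -/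
theorem not_twelveWithinOneEverywhere : ¬ TwelveWithinOneEverywhere := by
  intro h
  obtain ⟨N, hN1, hN⟩ := ((eventually_ge_atTop 1).and (h gs gs_isGroundState)).exists
  obtain ⟨i, hi⟩ := exists_not_goodWith_twelve hN1 (gs N)
  exact hi (hN i)


/-! ## Part D — sanity: the predicate is satisfiable (the fcc shell), so K2 is not trivially false -/

/-- Integer coordinate table (unit `1/10`): the centre and the twelve fcc shell vectors
`(±7, ±7, 0)` and permutations (bond length `7√2/10 = 0.98995 ∈ [55/57, 1]`; `t = 7` is the only
tenth with `t√2/10` in that window). -/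
def tab : Fin 13 → Fin 3 → ℤ :=
  ![![0, 0, 0], ![7, 7, 0], ![7, -7, 0], ![-7, 7, 0], ![-7, -7, 0], ![7, 0, 7], ![7, 0, -7],
    ![-7, 0, 7], ![-7, 0, -7], ![0, 7, 7], ![0, 7, -7], ![0, -7, 7], ![0, -7, -7]]

/-- Squared distances of the table, in units `1/100`. -/
def sqd (i j : Fin 13) : ℤ := ∑ k : Fin 3, (tab i k - tab j k) ^ 2

/-- All 78 mutual squared distances are `≥ 98 ≥ 100·(55/57)²` (checked by `decide`). [folklore] -/
theorem sqd_sep : ∀ i j : Fin 13, i ≠ j → (302500 : ℤ) ≤ 3249 * sqd i j := by decide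

/-- The twelve shell points are at squared distance `98 ≤ 100` from the centre. [folklore] -/
theorem sqd_shell : ∀ j : Fin 13, j ≠ 0 → sqd 0 j ≤ 100 := by decide

/-- The fcc cluster: centre plus first coordination shell at bond length `0.98995`. -/
def fcc13 (i : Fin 13) : E3 := WithLp.toLp 2 fun k => ((tab i k : ℝ)) / 10

/-- Squared distances of `fcc13` from the integer table. [folklore] -/
theorem dist_sq_fcc13 (i j : Fin 13) : dist (fcc13 i) (fcc13 j) ^ 2 = (sqd i j : ℝ) / 100 := by
  rw [EuclideanSpace.dist_eq, Real.sq_sqrt (Finset.sum_nonneg fun _ _ => sq_nonneg _)]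
  simp only [fcc13, PiLp.toLp_apply, Real.dist_eq, sq_abs, sqd]
  push_cast
  rw [Finset.sum_div]
  exact Finset.sum_congr rfl fun k _ => by ring

/-- `fcc13` is `55/57`-separated (indeed `0.98995`-separated). [folklore] -/
theorem sep_fcc13 {i j : Fin 13} (h : i ≠ j) : (55 : ℝ) / 57 ≤ dist (fcc13 i) (fcc13 j) := by
  have hz := sqd_sep i j h
  have hr : (302500 : ℝ) ≤ 3249 * (sqd i j : ℝ) := by exact_mod_cast hz
  have h1 : ((55 : ℝ) / 57) ^ 2 ≤ dist (fcc13 i) (fcc13 j) ^ 2 := by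
    rw [dist_sq_fcc13]; nlinarith
  exact le_of_pow_le_pow_left₀ two_ne_zero dist_nonneg h1

/-- The shell lies within distance `1` of the centre. [folklore] -/
theorem shell_fcc13 {j : Fin 13} (h : j ≠ 0) : dist (fcc13 0) (fcc13 j) ≤ 1 := by
  have hz := sqd_shell j h
  have hr : (sqd 0 j : ℝ) ≤ 100 := by exact_mod_cast hz
  have h1 : dist (fcc13 0) (fcc13 j) ^ 2 ≤ 1 ^ 2 := by
    rw [dist_sq_fcc13, one_pow]; linarith
  exact le_of_pow_le_pow_left₀ two_ne_zero zero_le_one h1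

/-- **`GoodWith 12` is satisfiable**: the centre of `fcc13` is a Good site (so the crux is not
false for the trivial reason of an unsatisfiable predicate; margins: bonds `0.98995` vs window
`[0.96491, 1]`). -/
theorem goodWith_twelve_fcc13 : GoodWith 12 fcc13 0 := by
  refine ⟨fun j _ k hk => sep_fcc13 (Ne.symm hk), ?_⟩
  have hsub : (Finset.univ.filter fun j : Fin 13 => j ≠ 0) ⊆ nbrs fcc13 0 := by
    intro j hj
    simp only [Finset.mem_filter, Finset.mem_univ, true_and] at hj
    simp only [nbrs, Finset.mem_filter, Finset.mem_univ, true_and]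
    exact ⟨hj, shell_fcc13 hj⟩
  have hc : (Finset.univ.filter fun j : Fin 13 => j ≠ 0).card = 12 := by decide
  exact hc.symm.le.trans (Finset.card_le_card hsub)

end Summit.AtomisticToContinuum.Crystallization.Cruxes.TwelveWithinOne.Disproof

end
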